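import Summits.KontsevichZagierPeriods.KontsevichZagierPeriods.Theorems.ValuedFieldSpecialisationCTConstructionDilateTyped
import Summits.KontsevichZagierPeriods.KontsevichZagierPeriods.Theorems.ValuedFieldSpecialisationClassLevelExpansionFibreDimOnePadding

/-!
# Route ValuedFieldSpecialisation — crux `CTConstruction`: permuting the typed block

Helper toward crux stmt-KontsevichZagierPeriods-3495 (`CTConstruction`), line `registered`, stub
`stub_perm_typedElementary` of the lead's "dilation elimination". A **typed elementary family**
`R : KZ.IntegralRep (B + d + 2)` has coordinates `z = (s, u, t, w)` (`s = z 0` the parameter,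
`u = z 1`, the typed block `t : Fin B → ℝ` at the indices `(Fin.castAdd d j).succ.succ`,
`w : Fin d → ℝ` at the indices `(Fin.natAdd B l).succ.succ`), domain `0 < s < 1`, `0 < u`,
`u ^ Q * s ^ p < 1`, `κ j * s ^ (e j) ≤ t j ≤ 1`, `w ∈ r.domain`, and integrand
`∏ (t j)⁻¹ * r.integrand w`. Relabelling the typed block by a permutation `σ` of `Fin B`
(`(κ, e) ↦ (κ ∘ σ, e ∘ σ)`) is a FIBRED move: the coordinate permutation `E` of
`Fin (B + d + 2)` fixing `0`, `1` and the `w`-block and acting by `σ⁻¹` on the typed block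
(`Equiv.Perm.extendDomain`) fixes the parameter index `0`, so `[R] - [R.reindex E]` is a fibred
change of variables (`of_sub_of_reindex_mem_fibredRelations`); the domain of `R.reindex E` is the
typed domain with data `(κ ∘ σ, e ∘ σ)` and its integrand is again the typed integrand
(`∏ (t (σ⁻¹ j))⁻¹ = ∏ (t j)⁻¹`, `Equiv.prod_comp`).

Sources: M. Kontsevich, D. Zagier, *Periods* (2001), §1.2 (rule (2)). No new definitions.
-/

noncomputable section

namespace Summit.KontsevichZagierPeriods.ValuedFieldSpecialisation

open MeasureTheory Set
open Literature.NumberTheory.Transcendental Literature.NumberTheory.Transcendental.KZ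

/-! ## The coordinate permutation acting on the typed block -/

/-- The indices `(Fin.castAdd d j).succ.succ` of the typed block are pairwise distinct.
[folklore] -/
theorem castAdd_succ_succ_injective (B d : ℕ) :
    Function.Injective (fun j : Fin B => ((Fin.castAdd d j).succ.succ : Fin (B + d + 1 + 1))) :=
  fun _ _ h => Fin.castAdd_injective _ _ (Fin.succ_inj.mp (Fin.succ_inj.mp h))

/-- An index `(Fin.natAdd B l).succ.succ` of the `w`-block is not an index of the typed block.
[folklore] -/
theorem natAdd_succ_succ_ne_castAdd_succ_succ {B d : ℕ} (l : Fin d) (j : Fin B) :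
    ((Fin.natAdd B l).succ.succ : Fin (B + d + 1 + 1)) ≠ (Fin.castAdd d j).succ.succ := fun h => by
  have h' := congrArg Fin.val h
  simp only [Fin.val_succ, Fin.val_natAdd, Fin.val_castAdd] at h'
  have := j.isLt
  omega

/-- **The relabelling of the typed block.** For a permutation `τ` of `Fin B` there is a
coordinate permutation `E` of `Fin (B + d + 2)` fixing `0`, `1` and the indices
`(Fin.natAdd B l).succ.succ` of the `w`-block, and acting by `τ` on the indices
`(Fin.castAdd d j).succ.succ` of the typed block (`Equiv.Perm.extendDomain` of `τ` along the
embedding `j ↦ (Fin.castAdd d j).succ.succ`). [folklore] -/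
theorem exists_perm_typedBlock (B d : ℕ) (τ : Equiv.Perm (Fin B)) :
    ∃ E : Equiv.Perm (Fin (B + d + 1 + 1)), E 0 = 0 ∧ E 1 = 1 ∧
      (∀ j : Fin B, E (Fin.castAdd d j).succ.succ = (Fin.castAdd d (τ j)).succ.succ) ∧
        ∀ l : Fin d, E (Fin.natAdd B l).succ.succ = (Fin.natAdd B l).succ.succ := by
  classical
  let ι : Fin B → Fin (B + d + 1 + 1) := fun j => (Fin.castAdd d j).succ.succ
  let f : Fin B ≃ {b : Fin (B + d + 1 + 1) // b ∈ Set.range ι} :=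
    Equiv.ofInjective ι (castAdd_succ_succ_injective B d)
  have hf : ∀ j : Fin B, ((f j : {b : Fin (B + d + 1 + 1) // b ∈ Set.range ι}) :
      Fin (B + d + 1 + 1)) = (Fin.castAdd d j).succ.succ := fun j => rfl
  refine ⟨τ.extendDomain f, ?_, ?_, fun j => ?_, fun l => ?_⟩
  · exact Equiv.Perm.extendDomain_apply_not_subtype τ f
      (by rintro ⟨j, hj⟩; exact succ_succ_ne_zero (Fin.castAdd d j) hj)
  · exact Equiv.Perm.extendDomain_apply_not_subtype τ f
      (by rintro ⟨j, hj⟩; exact succ_succ_ne_one (Fin.castAdd d j) hj)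
  · rw [← hf j, Equiv.Perm.extendDomain_apply_image τ f j, hf]
  · exact Equiv.Perm.extendDomain_apply_not_subtype τ f
      (by rintro ⟨j, hj⟩; exact natAdd_succ_succ_ne_castAdd_succ_succ l j hj.symm)

/-! ## The stub -/

/-- **Stub `stub_perm_typedElementary`.** For a typed elementary family `R` (lower-bound
coefficients `κ`, exponents `e`) and a permutation `σ` of the typed block, the relabelled
representation `R' = R.reindex E` — `E` the coordinate permutation fixing `0`, `1` and the
`w`-block and acting by `σ⁻¹` on the typed block — is the typed elementary family with data
`(κ ∘ σ, e ∘ σ)` (same integrand, `∏ (t (σ⁻¹ j))⁻¹ = ∏ (t j)⁻¹`), and `[R] - [R'] ∈ fibredRelations`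
because `E` fixes the parameter index `0` (`of_sub_of_reindex_mem_fibredRelations`).
[Kontsevich–Zagier 2001, §1.2 rule (2)] [folklore] -/
theorem stub_perm_typedElementary : ∀ (Q p B d : ℕ) (κ : Fin B → ℚ) (e : Fin B → ℕ) (r : Literature.NumberTheory.Transcendental.KZ.IntegralRep d) (σ : Equiv.Perm (Fin B)) (R : Literature.NumberTheory.Transcendental.KZ.IntegralRep (B + d + 1 + 1)), R.domain = {z | ∃ (s u : ℝ) (t : Fin B → ℝ) (w : Fin d → ℝ), z = Matrix.vecCons s (Matrix.vecCons u (Fin.append t w)) ∧ 0 < s ∧ s < 1 ∧ 0 < u ∧ u ^ Q * s ^ p < 1 ∧ (∀ j, ((κ j : ℚ) : ℝ) * s ^ (e j) ≤ t j ∧ t j ≤ 1) ∧ w ∈ r.domain} → R.integrand = (fun z => (∏ j : Fin B, (z (Fin.castAdd d j).succ.succ)⁻¹) * r.integrand (fun l : Fin d => z (Fin.natAdd B l).succ.succ)) → ∃ R' : Literature.NumberTheory.Transcendental.KZ.IntegralRep (B + d + 1 + 1), R'.domain = {z | ∃ (s u : ℝ) (t : Fin B → ℝ) (w : Fin d → ℝ),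 z = Matrix.vecCons s (Matrix.vecCons u (Fin.append t w)) ∧ 0 < s ∧ s < 1 ∧ 0 < u ∧ u ^ Q * s ^ p < 1 ∧ (∀ j, ((κ (σ j) : ℚ) : ℝ) * s ^ (e (σ j)) ≤ t j ∧ t j ≤ 1) ∧ w ∈ r.domain} ∧ R'.integrand = (fun z => (∏ j : Fin B, (z (Fin.castAdd d j).succ.succ)⁻¹) * r.integrand (fun l : Fin d => z (Fin.natAdd B l).succ.succ)) ∧ Literature.NumberTheory.Transcendental.KZ.of R - Literature.NumberTheory.Transcendental.KZ.of R' ∈ Literature.NumberTheory.Transcendental.KZ.fibredRelations := by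
  intro Q p B d κ e r σ R hR hRi
  -- coordinate forms of the two typed domains
  rw [typedDomain_eq Q p B (fun j => ((κ (σ j) : ℚ) : ℝ)) (fun j => e (σ j)) r]
  replace hR := hR.trans (typedDomain_eq Q p B (fun j => ((κ j : ℚ) : ℝ)) e r)
  -- the relabelling `E`: fixes `0`, `1`, the `w`-block, acts by `σ⁻¹` on the typed block
  obtain ⟨E, hE0, hE1, hEt, hEw⟩ := exists_perm_typedBlock B d σ.symm
  refine ⟨R.reindex E, ?_, ?_, of_sub_of_reindex_mem_fibredRelations R E hE0⟩
  · rw [IntegralRep.reindex_domain, hR]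
    ext w
    simp only [mem_setOf_eq, hE0, hE1, hEt, hEw]
    constructor
    · rintro ⟨h0, h1, hu, huq, ht, hw⟩
      exact ⟨h0, h1, hu, huq, fun j => by simpa using ht (σ j), hw⟩
    · rintro ⟨h0, h1, hu, huq, ht, hw⟩
      exact ⟨h0, h1, hu, huq, fun j => by simpa using ht (σ.symm j), hw⟩
  · rw [IntegralRep.reindex_integrand, hRi]
    funext w
    simp only [hEt, hEw]
    rw [Equiv.prod_comp σ.symm (fun j => (w (Fin.castAdd d j).succ.succ)⁻¹)]

end Summit.KontsevichZagierPeriods.ValuedFieldSpecialisation
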